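import Summits.HodgeConjecture.HodgeConjecture.Theorems.F0P2pK1wHolds                 -- ★ K1w hypothesis-free: `cmPrincipalSeries_isConstituentOf_weylConj_holds` (`JH(i_G(χ)) = JH(i_G(wχ))`)
import Literature.NumberTheory.Rogawski1990.U3PrincipalSeriesWeylConjugateUnfold       -- ★ `cmPrincipalSeries_isConstituentOf_weylConj_iff` (the applied form of K1w)
import Literature.NumberTheory.Automorphic.JacquetNonzeroEmbedsNormalizedInd          -- ★ brick A: Frobenius `exists_injective_intertwiningMap_normalizedInd_of_ne_zero`, `deltaChar_cmBorelTriple_eq_one_of_mem_N`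
import Literature.NumberTheory.Automorphic.IrreducibleClassesConstituents              -- ★ `IrrClass.IsConstituentOf.of_injective`
import Literature.NumberTheory.Rogawski1990.CMLocalAPacketMembers                      -- ★ `KeysCaseTwoLabels`, `Gqs`, `qsForm`
import HarnessLib

/-!
# F0 · P3c · line LH6 «StCharTS» — brick «PI2-ID» of organ (S-i): a SQUARE-INTEGRABLE irreducible class of `U(Φ₃)(L⁺_v)` whose normalised Jacquet
# module has the quotient character `χ_ξ` or `wχ_ξ` IS Keys' `π²(ξ_v)`

Cell `pub/hodgecm-mathlib`, crux H413 = `stmt-HodgeConjecture-24833` (lane `--supports … --as helper`), route HCCMUnconditional; seat LH6-p02 (g0), organ (S-i)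
`stub_StNoncuspidalMember` of the LH6 pay-down skeleton v2-pre (1c4dee0a07a606ce :296, ⊢ `aX π2 = 1` on the model `Gqs L v`).  THEOREMS ONLY, sorry-free.
HONEST LABEL: HC_CM is proved only modulo the printed citations (2 remaining named inputs hLiu418 24832, h413 24833) until rung 0 closes; this is the LAST STEP
of the in-house road to (S-i) [Rogawski1990, proof of L. 12.7.3 p. 195 «This is only possible if, up to ordering, `π₁ = π²(ξ)`»]: once the shell identity
(★ R2d `Representation.smoothTrace_indicator_shell_eq`) and the H-side evaluation (brick «XIG», [L. 12.5.1]) have shown that the `+1` member `πp` of the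
(β)-datum has the Jacquet exponent of `π²(ξ_v)`, i.e. that its normalised Jacquet module maps non-trivially to `ℂ_χ` for `χ = χ_ξ` (or its Weyl conjugate),
THIS file concludes `πp = π²`.

THE MATHEMATICS.  `v` a finite place of `L⁺` non-split in `L`, `G = U(Φ₃)(L⁺_v)` (★ `Gqs L v`), `B = TN` (★ `cmBorelTriple L 3 v`), `χ_ξ = cmXiTorusChar L v μ η₁ η₂`
(★; `= torusCharPair … 0 χ₁ η₂` with `χ₁ = (η₁ ∘ quotConj)·μ·‖·‖^{1/2}`), `wχ_ξ = torusCharPair … 0 (χ₁ ∘ σ)⁻¹ η₂`, Keys' labels `(π², πⁿ)` (★ `KeysCaseTwoLabels`: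
the constituents of `i_G(χ_ξ)` are exactly `{πⁿ, π²}`) with `πⁿ` NOT square-integrable modulo the centre.  Let `π = ⟦r⟧` be irreducible smooth and
square-integrable modulo the centre, with a non-zero `T`-map `ψ : r_B(π) → ℂ_χ`, `χ ∈ {χ_ξ, wχ_ξ}`.  Frobenius reciprocity (★ brick A
`exists_injective_intertwiningMap_normalizedInd_of_ne_zero`, `δ_B|_N = 1` ★ `deltaChar_cmBorelTriple_eq_one_of_mem_N`) embeds `r ↪ i_G(χ) = cmPrincipalSeries L 3 v χ`,
so `π` is a constituent of `i_G(χ)` (★ `IsConstituentOf.of_injective`), hence of `i_G(χ_ξ)` (K1w ★ `cmPrincipalSeries_isConstituentOf_weylConj_holds` if `χ = wχ_ξ`),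
hence `π ∈ {πⁿ, π²}`; `π` square-integrable and `πⁿ` not force `π = π²`. [Rogawski1990 §12.2 (2) p. 174; proof of L. 12.7.3 p. 195; BernsteinZelevinsky1977
Prop. 1.9 (b), Thm. 2.9; Casselman1995 Thm. 3.2.4.]

## References
* [Rogawski1990] J. D. Rogawski, *Automorphic Representations of Unitary Groups in Three Variables*, Ann. of Math. Stud. 123 (1990): §12.1 pp. 171–172; §12.2 (2)
  pp. 173–174; §12.7 proof of Lemma 12.7.3 p. 195.
* [BernsteinZelevinsky1977] I. N. Bernstein, A. V. Zelevinsky, *Induced representations of reductive p-adic groups I*, Ann. Sci. ÉNS 10 (1977): Prop. 1.9 (b), Thm. 2.9.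
* [Casselman1995] W. Casselman, *Introduction to the theory of admissible representations of p-adic reductive groups* (1995): Thm. 3.2.4 (Frobenius reciprocity).
-/

set_option autoImplicit false
-- the mandated namespace has the single-problem summit's repeated segment (`HodgeConjecture.HodgeConjecture`)
set_option linter.dupNamespace false

noncomputable section

open NumberField IsDedekindDomain MeasureTheory
open scoped Matrix

open Literature.NumberTheory Literature.NumberTheory.Automorphic Literature.NumberTheory.Automorphic.UnitaryGroup
open Literature.NumberTheory.GaloisRepresentations
open Literature.NumberTheory.Rogawski1990

namespace Summit.HodgeConjecture.HodgeConjecture.Cruxes.H413.F0P3cStCharTSPi2Id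

variable (L : Type) [Field L] [NumberField L] [IsCMField L] (v : HeightOneSpectrum (𝓞 ↥(maximalRealSubfield L)))

/-! ## §1 Frobenius: a quotient character of the normalised Jacquet module makes the class a constituent of the principal series -/

set_option synthInstance.maxHeartbeats 400000 in
set_option maxHeartbeats 4000000 in
/-- **An irreducible smooth `π = ⟦r⟧` of `U(Φ₃)(L⁺_v)` with a non-zero `T`-map `r_B(π) → ℂ_χ` is a constituent of `i_G(χ) = cmPrincipalSeries L 3 v χ`**
(Frobenius reciprocity ★ `exists_injective_intertwiningMap_normalizedInd_of_ne_zero` with `δ_B|_N = 1` ★ `deltaChar_cmBorelTriple_eq_one_of_mem_N`, then ★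
`IsConstituentOf.of_injective`).  Any finite `v`, any character `χ` of `T`. [cite: BernsteinZelevinsky1977, Prop. 1.9 (b)] [cite: Casselman1995, Thm. 3.2.4]
[cite: Rogawski1990, §12.1 pp. 171–172] -/
theorem isConstituentOf_cmPrincipalSeries_of_quotientCharacter (r : SmoothIrrep (Gqs L v))
    (χ : ↥(torusU (conjLocal L (IsCMField.complexConj L) v) (cmLocalForm L 3 v)) →* ℂˣ)
    (ψ : (haveI := locallyCompactSpace_cmBorelU L 3 v
      (r.ρ.normalizedJacquet (cmBorelTriple L 3 v)).IntertwiningMap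
        ((Representation.trivial ℂ ↥(torusU (conjLocal L (IsCMField.complexConj L) v) (cmLocalForm L 3 v)) ℂ).twist χ)))
    (hψ : ψ ≠ 0) :
    (IrrClass.mk r).IsConstituentOf (cmPrincipalSeries L 3 v χ) := by
  -- read `r.ρ` on the matrix carrier `U(Φ₃)(L⁺_v)` (the `abbrev Gqs` unfolds to it, but not at instance transparency)
  let π : Representation ℂ ↥(unitaryGroupOfForm (conjLocal L (IsCMField.complexConj L) v) (cmLocalForm L 3 v)) r.V := r.ρ
  have hirr : π.IsIrreducible := r.isIrreducible
  have hsm : π.IsSmooth := r.isSmooth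
  haveI := locallyCompactSpace_cmBorelU L 3 v
  have hex := @Representation.exists_injective_intertwiningMap_normalizedInd_of_ne_zero _ _ _ _ (cmBorelTriple L 3 v) _ r.V _ _ π hirr hsm
    (deltaChar_cmBorelTriple_eq_one_of_mem_N L 3 v) _ _ _ _ ψ hψ
  rcases hex with ⟨f, hf⟩
  exact IrrClass.IsConstituentOf.of_injective f hf (IrrClass.isConstituentOf_mk_self r)

/-! ## §2 «PI2-ID»: square-integrable + quotient character `χ_ξ` or `wχ_ξ` ⇒ the class is Keys' `π²` -/

set_option synthInstance.maxHeartbeats 400000 in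
set_option maxHeartbeats 4000000 in
/-- **«PI2-ID» (the last step of [Rogawski1990, proof of L. 12.7.3 p. 195]).**  At a NON-SPLIT finite place `v`, with Keys' labels `(π², πⁿ)` of `JH(i_G(χ_ξ))`,
`χ_ξ = cmXiTorusChar L v μ η₁ η₂`, and `πⁿ` not square-integrable modulo the centre: an irreducible smooth class `⟦r⟧` which IS square-integrable modulo the centre
and whose normalised Jacquet module has a non-zero `T`-map to `ℂ_χ` with `χ = χ_ξ` or `χ = wχ_ξ = ((χ₁ ∘ σ)⁻¹, η₂)` is `π²`: it is a constituent of `i_G(χ)` (§1),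
hence of `i_G(χ_ξ)` (K1w ★ for `wχ_ξ`), hence `∈ {πⁿ, π²}`, and not `πⁿ`. [cite: Rogawski1990, §12.7 proof of Lemma 12.7.3 p. 195; §12.2 (2) pp. 173–174]
[cite: BernsteinZelevinsky1977, Prop. 1.9 (b), Thm. 2.9] -/
theorem eq_pi2_of_isSquareIntegrable_of_quotientCharacter (hns : ∀ w : PlacesOver L v, IsCMField.complexConj L • w.1 = w.1)
    (μ : (UnitaryGroup.LocalRing L v)ˣ →* ℂˣ) (η₁ η₂ : ↥(normOneUnits (conjLocal L (IsCMField.complexConj L) v)) →* ℂˣ)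
    [MeasurableSpace (Gqs L v ⧸ Subgroup.center (Gqs L v))] (μZ : Measure (Gqs L v ⧸ Subgroup.center (Gqs L v)))
    {π2 πn : IrrClass (Gqs L v)} (hK : KeysCaseTwoLabels L v μ η₁ η₂ π2 πn) (hn : ¬ πn.IsSquareIntegrable μZ)
    (r : SmoothIrrep (Gqs L v)) (hL2 : (IrrClass.mk r).IsSquareIntegrable μZ)
    (χ : ↥(torusU (conjLocal L (IsCMField.complexConj L) v) (cmLocalForm L 3 v)) →* ℂˣ)
    (hχ : χ = cmXiTorusChar L v μ η₁ η₂ ∨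
      χ = torusCharPair (conjLocal L (IsCMField.complexConj L) v) (cmLocalForm L 3 v) (cmLocalForm_eq_over L 3 v) 0
        ((η₁.comp (quotConj (conjLocal L (IsCMField.complexConj L) v) (conjLocal_conjLocal_cm L v)) * μ *
            halfModulusChar (UnitaryGroup.LocalRing L v)).comp
          (Units.map (conjLocal L (IsCMField.complexConj L) v : UnitaryGroup.LocalRing L v →* UnitaryGroup.LocalRing L v)))⁻¹ η₂)
    (ψ : (haveI := locallyCompactSpace_cmBorelU L 3 v
      (r.ρ.normalizedJacquet (cmBorelTriple L 3 v)).IntertwiningMap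
        ((Representation.trivial ℂ ↥(torusU (conjLocal L (IsCMField.complexConj L) v) (cmLocalForm L 3 v)) ℂ).twist χ)))
    (hψ : ψ ≠ 0) :
    IrrClass.mk r = π2 := by
  -- `⟦r⟧` is a constituent of `i_G(χ)`
  have hc := isConstituentOf_cmPrincipalSeries_of_quotientCharacter L v r χ ψ hψ
  -- hence of `i_G(χ_ξ)` (K1w for the Weyl conjugate)
  have hcξ : (IrrClass.mk r).IsConstituentOf (cmPrincipalSeries L 3 v (cmXiTorusChar L v μ η₁ η₂)) := by
    rcases hχ with rfl | rfl
    · exact hc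
    · exact ((cmPrincipalSeries_isConstituentOf_weylConj_iff.1 F0P2pK1wHolds.cmPrincipalSeries_isConstituentOf_weylConj_holds) L v hns
        _ η₂ (IrrClass.mk r)).2 hc
  -- Keys: `⟦r⟧ ∈ {πⁿ, π²}`, and it is not `πⁿ`
  rcases (hK.2 (IrrClass.mk r)).1 hcξ with h | h
  · exact absurd (h ▸ hL2) hn
  · exact h

end Summit.HodgeConjecture.HodgeConjecture.Cruxes.H413.F0P3cStCharTSPi2Id

end
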